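import Summits.HubbardSuperconductivity.HubbardSuperconductivity.Theorems.CwSsbToEvenTorusLRO.Negative.WindowUniformity

/-!
# Crux `CwSsbToEvenTorusLRO` (item `stmt-HubbardSuperconductivity-10439`): the round-1 crux ideas under the
adversary — armour inheritance of guarded transfers, and the `NoBlockKink` stub encoding

Support file of the standing disprover (generation 2; workfile `Cruxes/CwSsbToEvenTorusLRO/Disproof.lean` §4–§5).
No definition is introduced; every shape is spelled out. Proved:

* `not_guarded_imp_order_io`, `uniform_of_guarded_pointwise`, `window_of_guardedWindow_pointwise`,
  `guardedWindow_of_guarded`, `unguarded_conjunct_not_armoured` — the four round-1 cards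
  (`griffiths-block-slope`, `block-slope-transport`, `kac-stiffness-poincare-closure`, `ssb-feeds-josephson-mirror`)
  file their transfers UNDER the crux's two hypotheses (`density matching → 0 < m → stubs`): refuting any of them
  requires density-matched Koma–Tasaki order at arbitrarily small coupling (the crux's own armour); the pointwise
  composition `stubs → matrix` closes both the crux's uniform shape and this route's window shape; a conjunct filed
  outside the guard (josephson's second conjunct) is not armoured.
* `symmSecondDiff_antitone`, `symmSecondDiff_nonpos` — for a concave energy density `e` the symmetric second-
  difference quotient `[e(κ) + e(-κ) - 2e(0)]/κ` of the stub `NoBlockKink` is antitone and nonpositive on `κ > 0`,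
  so the card's `∀ε ∃κ>0` encoding equals `∀ε, ∀ small κ` (`exists_iff_forall_small_of_antitone`);
  `tendsto_symmSecondDiff_of_differentiableAt`, `noKinkEncoding_of_limit`, `noBlockKinkAt_of_limit` — a
  thermodynamic limit of the block-perturbed grand-canonical energy density differentiable at `κ = 0` certifies the
  stub (supplier direction); `symmSecondDiff_negAbs`, `kink_defeats_encoding`, `symmSecondDiff_coexistence`,
  `coexistence_defeats_encoding` — a kink, in particular first-order coexistence with a block-poorer competitor
  (`e = min(w₁κ, w₂κ)`), defeats it.
* `hasDerivAt_bcsToyBlock`, `bcsToy_repelled_order_pos` — mean-field dictionary: the block term shifts the BCS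
  coupling `g ↦ g - κ`; the toy energy `κ ↦ -(N/2)(A e^{-1/(N(g-κ))})²` is differentiable at `κ = 0` with slope
  EXACTLY `(A e^{-1/(Ng)}/g)² = Φ(g)²` (no kink; the attractive-side floor `m²` is attained), and the repelled toy is
  ordered for every `κ < g`.
-/

noncomputable section

namespace Summit.HubbardSuperconductivity.HubbardSuperconductivity.Theorems.CwSsbToEvenTorusLRO.Negative

open Literature.MathematicalPhysics.QuantumLattice Literature.Barriers.HubbardSuperconductivity
open Literature.Probability.LatticeModels (TorusSite)
open Filter Set
open scoped Matrix ComplexOrder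
open _root_.Topology

/-! ### 1. Guarded transfers inherit the crux's armour -/

section Guarded

variable {D : ℝ → ℝ → ℝ → Prop} {m : ℝ → ℝ → ℝ} {M : ℝ → ℝ → Prop} {S : ℝ → ℝ → ℝ → Prop}

/-- **Armour inherited.** If a guarded transfer `∃U₀ ∀U<U₀ ∀δ<1/2 ∀μ, D → 0 < m → S` fails, then below every
`U₀` there is a density-matched, ordered parameter triple (at which the stub conjunction fails). [folklore] -/
theorem not_guarded_imp_order_io
    (h : ¬ ∃ U₀ : ℝ, 0 < U₀ ∧ ∀ U ∈ Ioo (0:ℝ) U₀, ∀ δ ∈ Ioo (0:ℝ) (1 / 2), ∀ μ : ℝ,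
      D U δ μ → 0 < m U μ → S U δ μ) :
    ∀ U₀ : ℝ, 0 < U₀ → ∃ U ∈ Ioo (0:ℝ) U₀, ∃ δ ∈ Ioo (0:ℝ) (1 / 2), ∃ μ : ℝ,
      D U δ μ ∧ 0 < m U μ ∧ ¬ S U δ μ := by
  simp only [not_exists, not_and, not_forall, exists_prop] at h
  intro U₀ hU₀
  obtain ⟨U, hU, δ, hδ, μ, hD, hm, hS⟩ := h U₀ hU₀
  exact ⟨U, hU, δ, hδ, μ, hD, hm, hS⟩

/-- A guarded transfer holds vacuously off the ordered regime. [folklore] -/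
theorem guarded_of_noOrder (h : ∃ U₀ : ℝ, 0 < U₀ ∧ ∀ U ∈ Ioo (0:ℝ) U₀, ∀ μ : ℝ, m U μ ≤ 0) :
    ∃ U₀ : ℝ, 0 < U₀ ∧ ∀ U ∈ Ioo (0:ℝ) U₀, ∀ δ ∈ Ioo (0:ℝ) (1 / 2), ∀ μ : ℝ,
      D U δ μ → 0 < m U μ → S U δ μ := by
  obtain ⟨U₀, hU₀, h⟩ := h
  exact ⟨U₀, hU₀, fun U hU δ _ μ _ hm => absurd hm (not_lt.2 (h U hU μ))⟩

/-- **Pointwise composition closes the uniform shape** (the crux's quantifier structure). [folklore] -/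
theorem uniform_of_guarded_pointwise
    (hG : ∃ U₀ : ℝ, 0 < U₀ ∧ ∀ U ∈ Ioo (0:ℝ) U₀, ∀ δ ∈ Ioo (0:ℝ) (1 / 2), ∀ μ : ℝ,
      D U δ μ → 0 < m U μ → S U δ μ)
    (hclose : ∀ U δ μ, D U δ μ → 0 < m U μ → S U δ μ → M U δ) :
    ∃ U₀ : ℝ, 0 < U₀ ∧ ∀ U ∈ Ioo (0:ℝ) U₀, ∀ δ ∈ Ioo (0:ℝ) (1 / 2), ∀ μ : ℝ,
      D U δ μ → 0 < m U μ → M U δ := by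
  obtain ⟨U₀, hU₀, h⟩ := hG
  exact ⟨U₀, hU₀, fun U hU δ hδ μ hD hm => hclose U δ μ hD hm (h U hU δ hδ μ hD hm)⟩

/-- The uniform guard implies the window guard (doping cut to `[3/10,12/25]`, floor `exp(-C/U²) ≤ m` in place
of `0 < m`, `U₀` allowed to depend on `C`). [folklore] -/
theorem guardedWindow_of_guarded
    (hG : ∃ U₀ : ℝ, 0 < U₀ ∧ ∀ U ∈ Ioo (0:ℝ) U₀, ∀ δ ∈ Ioo (0:ℝ) (1 / 2), ∀ μ : ℝ,
      D U δ μ → 0 < m U μ → S U δ μ) :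
    ∀ C : ℝ, 0 < C → ∃ U₀ : ℝ, 0 < U₀ ∧ ∀ U ∈ Ioo (0:ℝ) U₀, ∀ δ ∈ Icc (3 / 10 : ℝ) (12 / 25), ∀ μ : ℝ,
      D U δ μ → Real.exp (-C / U ^ 2) ≤ m U μ → S U δ μ := by
  obtain ⟨U₀, hU₀, h⟩ := hG
  intro C _
  exact ⟨U₀, hU₀, fun U hU δ hδ μ hD hfl =>
    h U hU δ (window_subset_Ioo hδ) μ hD (lt_of_lt_of_le (Real.exp_pos _) hfl)⟩

/-- **Pointwise composition closes this route's window shape** from the window guard. [folklore] -/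
theorem window_of_guardedWindow_pointwise
    (hG : ∀ C : ℝ, 0 < C → ∃ U₀ : ℝ, 0 < U₀ ∧ ∀ U ∈ Ioo (0:ℝ) U₀, ∀ δ ∈ Icc (3 / 10 : ℝ) (12 / 25), ∀ μ : ℝ,
      D U δ μ → Real.exp (-C / U ^ 2) ≤ m U μ → S U δ μ)
    (hclose : ∀ U δ μ, D U δ μ → 0 < m U μ → S U δ μ → M U δ) :
    ∀ C : ℝ, 0 < C → ∃ U₀ : ℝ, 0 < U₀ ∧ ∀ U ∈ Ioo (0:ℝ) U₀, ∀ δ ∈ Icc (3 / 10 : ℝ) (12 / 25), ∀ μ : ℝ,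
      D U δ μ → Real.exp (-C / U ^ 2) ≤ m U μ → M U δ := by
  intro C hC
  obtain ⟨U₀, hU₀, h⟩ := hG C hC
  exact ⟨U₀, hU₀, fun U hU δ hδ μ hD hfl =>
    hclose U δ μ hD (lt_of_lt_of_le (Real.exp_pos _) hfl) (h U hU δ hδ μ hD hfl)⟩

end Guarded

/-- **A conjunct filed WITHOUT the guard is not armoured**: with `m ≡ 0` every guarded transfer holds while an
unguarded conjunct `∀U<U₀ ∀δ, J U δ` can fail. [folklore] -/
theorem unguarded_conjunct_not_armoured :
    ∃ (m : ℝ → ℝ → ℝ) (J : ℝ → ℝ → Prop),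
      (∀ (D : ℝ → ℝ → ℝ → Prop) (S : ℝ → ℝ → ℝ → Prop),
        ∃ U₀ : ℝ, 0 < U₀ ∧ ∀ U ∈ Ioo (0:ℝ) U₀, ∀ δ ∈ Ioo (0:ℝ) (1 / 2), ∀ μ : ℝ,
          D U δ μ → 0 < m U μ → S U δ μ) ∧
      ¬ ∃ U₀ : ℝ, 0 < U₀ ∧ ∀ U ∈ Ioo (0:ℝ) U₀, ∀ δ ∈ Ioo (0:ℝ) (1 / 2), J U δ := by
  refine ⟨fun _ _ => 0, fun _ _ => False,
    fun D S => ⟨1, one_pos, fun U _ δ _ μ _ hm => absurd hm (lt_irrefl 0)⟩, ?_⟩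
  rintro ⟨U₀, hU₀, h⟩
  exact h (U₀ / 2) ⟨by linarith, by linarith⟩ (1 / 4) ⟨by norm_num, by norm_num⟩

/-! ### 2. The `NoBlockKink` encoding: antitone symmetric quotient, supplier lemma, counter-models -/

section KinkEncoding

/-- The symmetric second-difference quotient is the difference of the two secant slopes through `0`. [folklore] -/
theorem symmSecondDiff_eq_secants (e : ℝ → ℝ) (κ : ℝ) :
    (e κ + e (-κ) - 2 * e 0) / κ = (e κ - e 0) / (κ - 0) - (e (-κ) - e 0) / (-κ - 0) := by
  rw [sub_zero, show (-κ - 0 : ℝ) = -κ by ring, div_neg, sub_neg_eq_add, ← add_div]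
  congr 1
  ring

/-- The same with Mathlib's `slope`. [folklore] -/
theorem symmSecondDiff_eq_slope (e : ℝ → ℝ) (κ : ℝ) :
    (e κ + e (-κ) - 2 * e 0) / κ = slope e 0 κ - slope e 0 (-κ) := by
  rw [slope_def_field, slope_def_field, symmSecondDiff_eq_secants e κ]

/-- **For a concave function the symmetric second-difference quotient is antitone on `(0, ∞)`** (both
one-sided secants through `0` are monotone: `ConvexOn.secant_mono` for `-e`). [folklore] -/
theorem symmSecondDiff_antitone {e : ℝ → ℝ} (he : ConcaveOn ℝ univ e) {κ₁ κ₂ : ℝ} (h₁ : 0 < κ₁)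
    (h₁₂ : κ₁ ≤ κ₂) :
    (e κ₂ + e (-κ₂) - 2 * e 0) / κ₂ ≤ (e κ₁ + e (-κ₁) - 2 * e 0) / κ₁ := by
  have h₂ : 0 < κ₂ := lt_of_lt_of_le h₁ h₁₂
  have hc : ConvexOn ℝ univ (-e) := he.neg
  have s1 := hc.secant_mono (a := 0) (x := κ₁) (y := κ₂) (mem_univ _) (mem_univ _) (mem_univ _)
    h₁.ne' h₂.ne' h₁₂
  have s2 := hc.secant_mono (a := 0) (x := -κ₂) (y := -κ₁) (mem_univ _) (mem_univ _) (mem_univ _)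
    (neg_ne_zero.2 h₂.ne') (neg_ne_zero.2 h₁.ne') (neg_le_neg h₁₂)
  simp only [Pi.neg_apply] at s1 s2
  rw [symmSecondDiff_eq_secants e κ₁, symmSecondDiff_eq_secants e κ₂]
  have e1 : (-e κ₁ - -e 0) / (κ₁ - 0) = -((e κ₁ - e 0) / (κ₁ - 0)) := by ring
  have e2 : (-e κ₂ - -e 0) / (κ₂ - 0) = -((e κ₂ - e 0) / (κ₂ - 0)) := by ring
  have e3 : (-e (-κ₂) - -e 0) / (-κ₂ - 0) = -((e (-κ₂) - e 0) / (-κ₂ - 0)) := by ring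
  have e4 : (-e (-κ₁) - -e 0) / (-κ₁ - 0) = -((e (-κ₁) - e 0) / (-κ₁ - 0)) := by ring
  rw [e1, e2] at s1
  rw [e3, e4] at s2
  linarith

/-- Concavity makes the symmetric quotient nonpositive (the stub's `≤ 0` half is free). [folklore] -/
theorem symmSecondDiff_nonpos {e : ℝ → ℝ} (he : ConcaveOn ℝ univ e) {κ : ℝ} (hκ : 0 < κ) :
    (e κ + e (-κ) - 2 * e 0) / κ ≤ 0 := by
  have h := he.2 (mem_univ (-κ)) (mem_univ κ) (show (0:ℝ) ≤ 1 / 2 by norm_num)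
    (show (0:ℝ) ≤ 1 / 2 by norm_num) (by norm_num)
  simp only [smul_eq_mul] at h
  have hmid : (1 / 2 : ℝ) * -κ + 1 / 2 * κ = 0 := by ring
  rw [hmid] at h
  exact div_nonpos_of_nonpos_of_nonneg (by linarith) hκ.le

/-- For an antitone quotient the `∃ κ > 0` encoding is the `∀ small κ` encoding. [folklore] -/
theorem exists_iff_forall_small_of_antitone {Q : ℝ → ℝ}
    (hQ : ∀ κ₁ κ₂, 0 < κ₁ → κ₁ ≤ κ₂ → Q κ₂ ≤ Q κ₁) (ε : ℝ) :
    (∃ κ, 0 < κ ∧ -ε ≤ Q κ) ↔ ∃ κ₀, 0 < κ₀ ∧ ∀ κ ∈ Ioc (0:ℝ) κ₀, -ε ≤ Q κ := by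
  constructor
  · rintro ⟨κ, hκ, h⟩
    exact ⟨κ, hκ, fun κ' hκ' => h.trans (hQ κ' κ hκ'.1 hκ'.2)⟩
  · rintro ⟨κ₀, hκ₀, h⟩
    exact ⟨κ₀, hκ₀, h κ₀ ⟨hκ₀, le_rfl⟩⟩

/-- **Differentiability at `0` forces the symmetric quotient to `0`** (no concavity needed). [folklore] -/
theorem tendsto_symmSecondDiff_of_differentiableAt {e : ℝ → ℝ} (he : DifferentiableAt ℝ e 0) :
    Tendsto (fun κ => (e κ + e (-κ) - 2 * e 0) / κ) (𝓝[≠] 0) (𝓝 0) := by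
  have hs : Tendsto (slope e 0) (𝓝[≠] 0) (𝓝 (deriv e 0)) := he.hasDerivAt.tendsto_slope
  have hneg : Tendsto (fun κ : ℝ => -κ) (𝓝[≠] (0:ℝ)) (𝓝[≠] 0) := by
    rw [tendsto_nhdsWithin_iff]
    refine ⟨?_, ?_⟩
    · have : Tendsto (fun κ : ℝ => -κ) (𝓝 (0:ℝ)) (𝓝 0) := by
        simpa using (continuous_neg.tendsto (0:ℝ))
      exact this.mono_left nhdsWithin_le_nhds
    · filter_upwards [self_mem_nhdsWithin] with κ hκ
      simpa using hκ
  have hs' := hs.comp hneg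
  have hsub := hs.sub hs'
  rw [sub_self] at hsub
  refine hsub.congr' (Filter.Eventually.of_forall fun κ => ?_)
  show slope e 0 κ - (slope e 0 ∘ fun κ => -κ) κ = (e κ + e (-κ) - 2 * e 0) / κ
  rw [symmSecondDiff_eq_slope e κ]
  rfl

/-- **Supplier lemma (abstract).** Energies `E L κ` with a thermodynamic limit `E L κ / A L → e κ` (pointwise in
`κ`; `A L > 0` eventually) whose limit is differentiable at `κ = 0` satisfy the `NoBlockKink` encoding: for every
`ε > 0` some `κ > 0` has, eventually in `L`, `-(εκ)·A L ≤ E L κ + E L (-κ) - 2 E L 0`. [folklore] -/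
theorem noKinkEncoding_of_limit {E : ℕ → ℝ → ℝ} {A : ℕ → ℝ} {e : ℝ → ℝ}
    (hA : ∀ᶠ L in atTop, 0 < A L)
    (hlim : ∀ κ, Tendsto (fun L => E L κ / A L) atTop (𝓝 (e κ)))
    (he : DifferentiableAt ℝ e 0) :
    ∀ ε : ℝ, 0 < ε → ∃ κ : ℝ, 0 < κ ∧
      ∀ᶠ L in atTop, -(ε * κ) * A L ≤ E L κ + E L (-κ) - 2 * E L 0 := by
  intro ε hε
  have ht := tendsto_symmSecondDiff_of_differentiableAt he
  have hε2 : 0 < ε / 2 := by linarith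
  have hev : ∀ᶠ κ in 𝓝[≠] (0:ℝ), |(e κ + e (-κ) - 2 * e 0) / κ| < ε / 2 := by
    have := (Metric.tendsto_nhds.1 ht) (ε / 2) hε2
    filter_upwards [this] with κ hκ
    rw [Real.dist_eq, sub_zero] at hκ
    exact hκ
  have hev' : ∀ᶠ κ in 𝓝[>] (0:ℝ), |(e κ + e (-κ) - 2 * e 0) / κ| < ε / 2 ∧ 0 < κ := by
    have h1 : ∀ᶠ κ in 𝓝[>] (0:ℝ), |(e κ + e (-κ) - 2 * e 0) / κ| < ε / 2 :=
      hev.filter_mono (nhdsWithin_mono _ fun x hx => ne_of_gt hx)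
    have h2 : ∀ᶠ κ in 𝓝[>] (0:ℝ), 0 < κ := self_mem_nhdsWithin
    exact h1.and h2
  obtain ⟨κ, hκ, hκpos⟩ := hev'.exists
  refine ⟨κ, hκpos, ?_⟩
  have hl : Tendsto (fun L => (E L κ + E L (-κ) - 2 * E L 0) / A L) atTop
      (𝓝 (e κ + e (-κ) - 2 * e 0)) := by
    have := ((hlim κ).add (hlim (-κ))).sub ((hlim 0).const_mul 2)
    refine this.congr' ?_
    filter_upwards [hA] with L hL
    field_simp
  have hval : -(ε * κ) < e κ + e (-κ) - 2 * e 0 := by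
    have hq : (e κ + e (-κ) - 2 * e 0) / κ * κ = e κ + e (-κ) - 2 * e 0 := by field_simp
    rw [← hq]
    have := (abs_lt.1 hκ).1
    nlinarith
  have hev2 := hl.eventually (lt_mem_nhds hval)
  filter_upwards [hev2, hA] with L hL hAL
  rw [lt_div_iff₀ hAL] at hL
  linarith

/-- **Supplier lemma at the tree's objects**: a thermodynamic limit of the zero-source block-perturbed
grand-canonical energy density `E₀(K_μ + κ W_R)/L²` (`W_R = R⁻⁴ Σ_a B_aᴴB_a`, `B_a = Σ_{u∈[0,R)²} P_{a+u}`, the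
Kac block operator of both block cards, spelled out) for `κ` near `0`, differentiable at `κ = 0`, certifies the
stub `NoBlockKink` at scale `R`. [folklore] -/
theorem noBlockKinkAt_of_limit {U μ : ℝ} {R : ℕ} {e : ℝ → ℝ}
    (hlim : ∀ κ : ℝ, Tendsto (fun L : ℕ =>
      (dWaveSourceTorus (L + 1) U μ 0 + (κ : ℂ) • (((((R : ℝ) ^ 4)⁻¹ : ℝ) : ℂ) •
        ∑ a : TorusSite 2 (L + 1),
          (∑ u : Fin 2 → Fin R, localPair dWaveFormFactor (L + 1) (a + fun i => ((u i : ℕ) : ZMod (L + 1))))ᴴ *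
            (∑ u : Fin 2 → Fin R,
              localPair dWaveFormFactor (L + 1) (a + fun i => ((u i : ℕ) : ZMod (L + 1)))))).groundEnergy /
        ((L + 1 : ℕ) : ℝ) ^ 2) atTop (𝓝 (e κ)))
    (he : DifferentiableAt ℝ e 0) :
    ∀ ε : ℝ, 0 < ε → ∃ κ : ℝ, 0 < κ ∧ ∀ᶠ L : ℕ in atTop,
      -(ε * κ) * ((L + 1 : ℕ) : ℝ) ^ 2 ≤
        (dWaveSourceTorus (L + 1) U μ 0 + (κ : ℂ) • (((((R : ℝ) ^ 4)⁻¹ : ℝ) : ℂ) •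
          ∑ a : TorusSite 2 (L + 1),
            (∑ u : Fin 2 → Fin R, localPair dWaveFormFactor (L + 1) (a + fun i => ((u i : ℕ) : ZMod (L + 1))))ᴴ *
              (∑ u : Fin 2 → Fin R,
                localPair dWaveFormFactor (L + 1) (a + fun i => ((u i : ℕ) : ZMod (L + 1)))))).groundEnergy +
        (dWaveSourceTorus (L + 1) U μ 0 + ((-κ : ℝ) : ℂ) • (((((R : ℝ) ^ 4)⁻¹ : ℝ) : ℂ) •
          ∑ a : TorusSite 2 (L + 1),
            (∑ u : Fin 2 → Fin R, localPair dWaveFormFactor (L + 1) (a + fun i => ((u i : ℕ) : ZMod (L + 1))))ᴴ *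
              (∑ u : Fin 2 → Fin R,
                localPair dWaveFormFactor (L + 1) (a + fun i => ((u i : ℕ) : ZMod (L + 1)))))).groundEnergy -
        2 * (dWaveSourceTorus (L + 1) U μ 0 + ((0 : ℝ) : ℂ) • (((((R : ℝ) ^ 4)⁻¹ : ℝ) : ℂ) •
          ∑ a : TorusSite 2 (L + 1),
            (∑ u : Fin 2 → Fin R, localPair dWaveFormFactor (L + 1) (a + fun i => ((u i : ℕ) : ZMod (L + 1))))ᴴ *
              (∑ u : Fin 2 → Fin R,
                localPair dWaveFormFactor (L + 1) (a + fun i => ((u i : ℕ) : ZMod (L + 1)))))).groundEnergy := by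
  intro ε hε
  have hA : ∀ᶠ L : ℕ in atTop, (0:ℝ) < ((L + 1 : ℕ) : ℝ) ^ 2 :=
    Filter.Eventually.of_forall fun L => by positivity
  exact noKinkEncoding_of_limit (E := fun L κ =>
      (dWaveSourceTorus (L + 1) U μ 0 + (κ : ℂ) • (((((R : ℝ) ^ 4)⁻¹ : ℝ) : ℂ) •
        ∑ a : TorusSite 2 (L + 1),
          (∑ u : Fin 2 → Fin R, localPair dWaveFormFactor (L + 1) (a + fun i => ((u i : ℕ) : ZMod (L + 1))))ᴴ *
            (∑ u : Fin 2 → Fin R,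
              localPair dWaveFormFactor (L + 1) (a + fun i => ((u i : ℕ) : ZMod (L + 1)))))).groundEnergy)
    (A := fun L => ((L + 1 : ℕ) : ℝ) ^ 2) hA hlim he ε hε

/-- **A kink defeats the encoding**: for `e x = -|x|` the quotient is `-2` at every `κ > 0`. [folklore] -/
theorem symmSecondDiff_negAbs {κ : ℝ} (hκ : 0 < κ) : (-|κ| + -|-κ| - 2 * -|(0:ℝ)|) / κ = -2 := by
  have hκ' : κ ≠ 0 := hκ.ne'
  simp only [abs_neg, abs_zero, abs_of_pos hκ, neg_zero, mul_zero, sub_zero]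
  field_simp
  ring

/-- … so the `∀ε ∃κ>0` encoding fails for `e x = -|x|`. [folklore] -/
theorem kink_defeats_encoding :
    ¬ ∀ ε : ℝ, 0 < ε → ∃ κ : ℝ, 0 < κ ∧ -ε ≤ (-|κ| + -|-κ| - 2 * -|(0:ℝ)|) / κ := by
  intro h
  obtain ⟨κ, hκ, hle⟩ := h 1 one_pos
  rw [symmSecondDiff_negAbs hκ] at hle
  linarith

/-- **First-order coexistence caricature**: two iso-`μ` phases with energy densities `w₁κ`, `w₂κ` in the block
coupling (equal at `κ = 0`, block coherences `w₁ > w₂`); the grand-canonical density is the minimum — concave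
with a kink: the quotient is `w₂ - w₁ < 0` at every `κ > 0`. [folklore] -/
theorem symmSecondDiff_coexistence {w₁ w₂ κ : ℝ} (hw : w₂ < w₁) (hκ : 0 < κ) :
    (min (w₁ * κ) (w₂ * κ) + min (w₁ * -κ) (w₂ * -κ) - 2 * min (w₁ * 0) (w₂ * 0)) / κ = w₂ - w₁ := by
  have h1 : min (w₁ * κ) (w₂ * κ) = w₂ * κ := min_eq_right (by nlinarith)
  have h2 : min (w₁ * -κ) (w₂ * -κ) = w₁ * -κ := min_eq_left (by nlinarith)
  have hκ' : κ ≠ 0 := hκ.ne'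
  simp only [h1, h2, mul_zero, min_self, sub_zero]
  field_simp
  ring

/-- … so the encoding fails at coexistence (take `ε = (w₁ - w₂)/2`). [folklore] -/
theorem coexistence_defeats_encoding {w₁ w₂ : ℝ} (hw : w₂ < w₁) :
    ¬ ∀ ε : ℝ, 0 < ε → ∃ κ : ℝ, 0 < κ ∧
      -ε ≤ (min (w₁ * κ) (w₂ * κ) + min (w₁ * -κ) (w₂ * -κ) - 2 * min (w₁ * 0) (w₂ * 0)) / κ := by
  intro h
  obtain ⟨κ, hκ, hle⟩ := h ((w₁ - w₂) / 2) (by linarith)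
  rw [symmSecondDiff_coexistence hw hκ] at hle
  linarith

end KinkEncoding

/-! ### 3. Mean-field dictionary: the block term shifts the BCS coupling `g ↦ g - κ`; no kink, sharp slope -/

section MeanFieldToy

variable {A N g κ : ℝ}

/-- Derivative of the toy gap `g ↦ A e^{-1/(Ng)}`. [folklore] -/
theorem hasDerivAt_bcsToyGap (A : ℝ) (hN : N ≠ 0) (hg : g ≠ 0) :
    HasDerivAt (fun x => A * Real.exp (-(1 / (N * x))))
      (A * Real.exp (-(1 / (N * g))) * (1 / (N * g ^ 2))) g := by
  have h1 : HasDerivAt (fun x : ℝ => -(1 / (N * x))) (1 / (N * g ^ 2)) g := by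
    have h0 := ((hasDerivAt_inv hg).const_mul N⁻¹).neg
    have e1 : (fun x : ℝ => -(1 / (N * x))) = fun x => -(N⁻¹ * x⁻¹) := by
      ext x; rw [one_div, mul_inv]
    rw [e1]
    refine h0.congr_deriv ?_
    field_simp
  refine ((h1.exp).const_mul A).congr_deriv ?_
  ring

/-- **Hellmann–Feynman in the toy**: `d/dg [-(N/2)(A e^{-1/(Ng)})²] = -(A e^{-1/(Ng)}/g)² = -Φ(g)²`. [folklore] -/
theorem hasDerivAt_bcsToyEnergy (A : ℝ) (hN : N ≠ 0) (hg : g ≠ 0) :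
    HasDerivAt (fun x => -(N / 2) * (A * Real.exp (-(1 / (N * x)))) ^ 2)
      (-(A * Real.exp (-(1 / (N * g))) / g) ^ 2) g := by
  have hG := hasDerivAt_bcsToyGap A hN hg
  have h := (hG.mul hG).const_mul (-(N / 2))
  have e2 : (fun x => -(N / 2) * (A * Real.exp (-(1 / (N * x)))) ^ 2) =
      fun x => -(N / 2) * ((A * Real.exp (-(1 / (N * x)))) * (A * Real.exp (-(1 / (N * x))))) := by
    funext x; rw [pow_two]
  rw [e2]
  refine h.congr_deriv ?_
  field_simp
  ring

/-- **No kink, sharp slope (mean field).** With the block coupling shifting `g ↦ g - κ`, the toy energy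
`κ ↦ e(g - κ)` is differentiable at `κ = 0` with derivative EXACTLY `Φ(g)² = m²`: griffiths' (A) `NoBlockKink`
and block-slope's (D) hold at mean field and the floor `m²` of `AttractiveBlockGain` is attained. [folklore] -/
theorem hasDerivAt_bcsToyBlock (A : ℝ) (hN : N ≠ 0) (hg : g ≠ 0) :
    HasDerivAt (fun κ => -(N / 2) * (A * Real.exp (-(1 / (N * (g - κ))))) ^ 2)
      ((A * Real.exp (-(1 / (N * g))) / g) ^ 2) 0 := by
  have hsub : HasDerivAt (fun κ : ℝ => g - κ) (-1) 0 := by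
    simpa using (hasDerivAt_id (0:ℝ)).const_sub g
  have hg0 : g - 0 ≠ 0 := by simpa using hg
  have h := (hasDerivAt_bcsToyEnergy A hN hg0).comp (0:ℝ) hsub
  refine h.congr_deriv ?_
  rw [sub_zero]
  ring

/-- **(B) at mean field**: the repelled toy `g - κ` is ordered (`Φ > 0`) for every `κ < g` (`A > 0`). [folklore] -/
theorem bcsToy_repelled_order_pos (hA : 0 < A) (N : ℝ) (hκ : κ < g) :
    0 < A * Real.exp (-(1 / (N * (g - κ)))) / (g - κ) :=
  div_pos (mul_pos hA (Real.exp_pos _)) (sub_pos.2 hκ)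

end MeanFieldToy

end Summit.HubbardSuperconductivity.HubbardSuperconductivity.Theorems.CwSsbToEvenTorusLRO.Negative

end
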